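import Summits.ValiantsHypothesis.ValiantsHypothesis.Theorems.SymPencilPerFourPeeledTwoPencilFrameData
import Summits.ValiantsHypothesis.ValiantsHypothesis.Theorems.SymPencilPerFourPeeledTwoPencilCaseAQ

/-!
# Route `SymPencil` — inner rank of the `2 | 2` row split of `per_4`, PEELED case: the `e₃` CHART
# for a general correction matrix and the COLUMN-KILL class of the (8,8,11) coverage programme
# (`--supports` stmt-ValiantsHypothesis-5674 `SdcSuperquadratic`; (8,8) column, memo
# `NOTE-p8g15-5674-R2-two-pencil.md` §9.3 shape `e_m`, §9.4 R1; rung currency only)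

Two lemmas in the currency of `…TwoPencilFrameless.false_of_peeled_of_frame_at` (the matrix-level
frame body):

* `frames_of_e3_of_indep` — the `e₃` chart for a GENERAL `Ψ`: if `a₀` has non-zero coordinates,
  `a₁ ∉ K a₀`, and the four incidences `a_j ⬝ Ψ (a₀ ∘ z_i) = 0` hold for the Case-A points with the
  FREE triple `h = (1,2,3)`, `τ = 1`, i.e. `z₀ = (5,−1,−1,0)`, `z₁ = (3,0,−1,0)`, then the two-pencil
  frame package exists (`…TwoPencilCaseA.caseA_data`, `…TwoPencilCaseAQ.caseA_Q_ne_zero`,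
  `…TwoPencilFrameData.frameData_of_hess`; `…TwoPencilZeroColumns.frames_of_three_zero_columns`
  (p8 g15) is the special case `a₀ = 𝟙`, `a₁ = (1,2,3,4)`, columns `0,1,2` zero);
* `frames_of_two_zero_columns_kill` — class R1 with a "killable" column: columns `1, 2` of `Ψ`
  vanish and column `0` has at least two non-zero entries (rows `p ≠ q`).  Then some `a₀` with
  non-zero coordinates is orthogonal to column `0` (one of `𝟙 − s e_q`, `𝟙 + e_p − s e_q` works),
  `a₁ := a₀ + (Ψ_{q0} e_p − Ψ_{p0} e_q)` is orthogonal to it too and is not a multiple of `a₀`, so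
  `a₀ ∘ Ψᵀ a_j ∈ K e₃` and the incidences of the `e₃` chart hold (the `z_i` have last coordinate `0`).

Honest framing: class lemmas of the `(8,8,11)` coverage programme; no cell closes here; the window
`28 ≤ sdc(per₄) ≤ 29` of record, the crux `SdcSuperquadratic` and `VP ≠ VNP` are untouched.  No
definitions, no named facts. [folklore]
-/

noncomputable section

-- single-conjunct layout: Sub = Summit, duplicated namespace component intended
set_option linter.dupNamespace false

namespace Summit.ValiantsHypothesis.ValiantsHypothesis.Theorems.SymPencilPerFourPeeledTwoPencilColumnKill

open Matrix Finset Module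

universe u

variable {K : Type u} [Field K]

/-- **The `e₃` chart for a general `Ψ`** (Case-A pencil with free triple `h = (1,2,3)`, `τ = 1`).
[folklore] -/
theorem frames_of_e3_of_indep [CharZero K] (Ψ : Matrix (Fin 4) (Fin 4) K) (a₀ a₁ : Fin 4 → K)
    (ha : ∀ k, a₀ k ≠ 0) (hind : ∀ μ : K, a₁ ≠ μ • a₀)
    (hψ₀₀ : a₀ ⬝ᵥ Ψ *ᵥ (fun k => a₀ k * (![5, -1, -1, 0] : Fin 4 → K) k) = 0)
    (hψ₀₁ : a₀ ⬝ᵥ Ψ *ᵥ (fun k => a₀ k * (![3, 0, -1, 0] : Fin 4 → K) k) = 0)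
    (hψ₁₀ : a₁ ⬝ᵥ Ψ *ᵥ (fun k => a₀ k * (![5, -1, -1, 0] : Fin 4 → K) k) = 0)
    (hψ₁₁ : a₁ ⬝ᵥ Ψ *ᵥ (fun k => a₀ k * (![3, 0, -1, 0] : Fin 4 → K) k) = 0) :
    ∃ (a₀ a₁ y₀ y₁ : Fin 4 → K) (P₀₀ P₁₀ P₀₁ P₁₁ W₀ : Matrix (Fin 4) (Fin 4) K)
        (v : Fin 4 → Fin 4 → K) (s : Fin 4 → K) (W : Matrix (Fin 4) (Fin 4) K),
        a₀ ⬝ᵥ Ψ *ᵥ y₀ = 0 ∧ a₀ ⬝ᵥ Ψ *ᵥ y₁ = 0 ∧ a₁ ⬝ᵥ Ψ *ᵥ y₀ = 0 ∧ a₁ ⬝ᵥ Ψ *ᵥ y₁ = 0 ∧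
        (∀ b l, P₀₀ b l = (Matrix.of ![a₀, Pi.single b 1, y₀, Pi.single l 1]).permanent) ∧
        (∀ b l, P₁₀ b l = (Matrix.of ![a₀, Pi.single b 1, y₁, Pi.single l 1]).permanent) ∧
        (∀ b l, P₀₁ b l = (Matrix.of ![a₁, Pi.single b 1, y₀, Pi.single l 1]).permanent) ∧
        (∀ b l, P₁₁ b l = (Matrix.of ![a₁, Pi.single b 1, y₁, Pi.single l 1]).permanent) ∧
        W₀ * P₀₀ = 1 ∧ (∀ j, P₁₀ *ᵥ v j = s j • P₀₀ *ᵥ v j) ∧ (∀ i j, i ≠ j → s i ≠ s j) ∧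
        W * Matrix.of v = 1 ∧ P₁₁ - P₁₀ * W₀ * P₀₁ ≠ 0 := by
  classical
  -- the free triple `h = (1,2,3)` and `τ = 1`
  obtain ⟨h, hh⟩ : ∃ h : Fin 4 → K, h = ![1, 2, 3, 0] := ⟨_, rfl⟩
  have h0 : h 0 ≠ 0 := by rw [hh]; simp
  have h1 : h 1 ≠ 0 := by rw [hh]; simp
  have h2 : h 2 ≠ 0 := by rw [hh]; simp
  have h01 : h 0 ≠ h 1 := by rw [hh]; simp
  have h02 : h 0 ≠ h 2 := by rw [hh]; simp
  have h12 : h 1 ≠ h 2 := by rw [hh]; simp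
  have hτ : (1 : K) ≠ 0 := one_ne_zero
  have hτ1 : h 1 + 1 * h 2 ≠ 0 := by rw [hh]; simp; norm_num
  have hτ2 : (h 1 - h 0) + 1 * (h 2 - h 0) ≠ 0 := by rw [hh]; simp; norm_num
  -- the Case-A points are the literal `z₀ = (5,-1,-1,0)`, `z₁ = (3,0,-1,0)`
  have ez₀ : (![h 1 + 1 * h 2, -h 0, -(1 * h 0), 0] : Fin 4 → K) = ![5, -1, -1, 0] := by
    rw [hh]; simp; norm_num
  have ez₁ : (![h 2, 0, -h 0, 0] : Fin 4 → K) = ![3, 0, -1, 0] := by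
    rw [hh]; ext k; fin_cases k <;> simp
  -- the Hessian matrices
  obtain ⟨H₀, hH₀⟩ : ∃ H₀ : Matrix (Fin 4) (Fin 4) K, ∀ b l, H₀ b l = if b = l then 0 else
      ((![h 1 + 1 * h 2, -h 0, -(1 * h 0), 0] : Fin 4 → K) 0 +
        (![h 1 + 1 * h 2, -h 0, -(1 * h 0), 0] : Fin 4 → K) 1 +
        (![h 1 + 1 * h 2, -h 0, -(1 * h 0), 0] : Fin 4 → K) 2 +
        (![h 1 + 1 * h 2, -h 0, -(1 * h 0), 0] : Fin 4 → K) 3) -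
        (![h 1 + 1 * h 2, -h 0, -(1 * h 0), 0] : Fin 4 → K) b -
        (![h 1 + 1 * h 2, -h 0, -(1 * h 0), 0] : Fin 4 → K) l :=
    ⟨Matrix.of fun b l => _, fun b l => rfl⟩
  obtain ⟨H₁, hH₁⟩ : ∃ H₁ : Matrix (Fin 4) (Fin 4) K, ∀ b l, H₁ b l = if b = l then 0 else
      ((![h 2, 0, -h 0, 0] : Fin 4 → K) 0 + (![h 2, 0, -h 0, 0] : Fin 4 → K) 1 +
        (![h 2, 0, -h 0, 0] : Fin 4 → K) 2 + (![h 2, 0, -h 0, 0] : Fin 4 → K) 3) -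
        (![h 2, 0, -h 0, 0] : Fin 4 → K) b - (![h 2, 0, -h 0, 0] : Fin 4 → K) l :=
    ⟨Matrix.of fun b l => _, fun b l => rfl⟩
  obtain ⟨hinv, hvh, hsh, hW⟩ :=
    SymPencilPerFourPeeledTwoPencilCaseA.caseA_data h 1 h0 h1 h2 h01 h02 h12 hτ hτ1 hτ2
      H₀ H₁ hH₀ hH₁
  have hQ :=
    SymPencilPerFourPeeledTwoPencilCaseAQ.caseA_Q_ne_zero a₀ a₁ ha hind h 1 h0 h01 h02 h12
      hτ hτ1 hτ2 H₀ hH₀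
  rw [← ez₀] at hψ₀₀ hψ₁₀
  rw [← ez₁] at hψ₀₁ hψ₁₁
  exact SymPencilPerFourPeeledTwoPencilFrameData.frameData_of_hess Ψ a₀ a₁ _ _ ha
    hψ₀₀ hψ₀₁ hψ₁₀ hψ₁₁ H₀ H₁ hH₀ hH₁ H₀⁻¹ hinv _ _ hvh hsh _ hW hQ

/-- **Class R1, killable column**: columns `1, 2` of `Ψ` vanish and column `0` has two non-zero
entries (rows `p ≠ q`). [folklore] -/
theorem frames_of_two_zero_columns_kill [CharZero K] (Ψ : Matrix (Fin 4) (Fin 4) K)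
    (h1 : ∀ i, Ψ i 1 = 0) (h2 : ∀ i, Ψ i 2 = 0) (p q : Fin 4) (hpq : p ≠ q)
    (hp : Ψ p 0 ≠ 0) (hq : Ψ q 0 ≠ 0) :
    ∃ (a₀ a₁ y₀ y₁ : Fin 4 → K) (P₀₀ P₁₀ P₀₁ P₁₁ W₀ : Matrix (Fin 4) (Fin 4) K)
        (v : Fin 4 → Fin 4 → K) (s : Fin 4 → K) (W : Matrix (Fin 4) (Fin 4) K),
        a₀ ⬝ᵥ Ψ *ᵥ y₀ = 0 ∧ a₀ ⬝ᵥ Ψ *ᵥ y₁ = 0 ∧ a₁ ⬝ᵥ Ψ *ᵥ y₀ = 0 ∧ a₁ ⬝ᵥ Ψ *ᵥ y₁ = 0 ∧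
        (∀ b l, P₀₀ b l = (Matrix.of ![a₀, Pi.single b 1, y₀, Pi.single l 1]).permanent) ∧
        (∀ b l, P₁₀ b l = (Matrix.of ![a₀, Pi.single b 1, y₁, Pi.single l 1]).permanent) ∧
        (∀ b l, P₀₁ b l = (Matrix.of ![a₁, Pi.single b 1, y₀, Pi.single l 1]).permanent) ∧
        (∀ b l, P₁₁ b l = (Matrix.of ![a₁, Pi.single b 1, y₁, Pi.single l 1]).permanent) ∧
        W₀ * P₀₀ = 1 ∧ (∀ j, P₁₀ *ᵥ v j = s j • P₀₀ *ᵥ v j) ∧ (∀ i j, i ≠ j → s i ≠ s j) ∧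
        W * Matrix.of v = 1 ∧ P₁₁ - P₁₀ * W₀ * P₀₁ ≠ 0 := by
  classical
  -- column `0` as a vector, and the reduction of every incidence to `c ⬝ a = 0`
  set c : Fin 4 → K := fun i => Ψ i 0 with hc
  have hred : ∀ (a z : Fin 4 → K) (w : Fin 4 → K), z 3 = 0 → c ⬝ᵥ a = 0 →
      a ⬝ᵥ Ψ *ᵥ (fun k => w k * z k) = 0 := by
    intro a z w hz hca
    have hcol : ∀ i, (Ψ *ᵥ fun k => w k * z k) i = Ψ i 0 * (w 0 * z 0) := by
      intro i
      simp only [Matrix.mulVec, dotProduct, Fin.sum_univ_four, h1 i, h2 i, hz]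
      ring
    calc a ⬝ᵥ Ψ *ᵥ (fun k => w k * z k) = ∑ i, a i * (Ψ i 0 * (w 0 * z 0)) := by
          simp only [dotProduct, hcol]
      _ = (c ⬝ᵥ a) * (w 0 * z 0) := by
          simp only [dotProduct, hc, Finset.sum_mul]
          exact Finset.sum_congr rfl fun i _ => by ring
      _ = 0 := by rw [hca, zero_mul]
  -- a third index, where the kernel vector `w` vanishes
  obtain ⟨m, hmp, hmq⟩ : ∃ m : Fin 4, m ≠ p ∧ m ≠ q := by
    have : ∀ p q : Fin 4, ∃ m : Fin 4, m ≠ p ∧ m ≠ q := by decide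
    exact this p q
  -- the kernel vector `w = c_q e_p - c_p e_q`
  let w : Fin 4 → K := Ψ q 0 • Pi.single p 1 - Ψ p 0 • Pi.single q 1
  have hcw : c ⬝ᵥ w = 0 := by
    simp only [w, dotProduct_sub, dotProduct_smul, dotProduct_single, mul_one, smul_eq_mul, hc]
    ring
  have hwm : w m = 0 := by
    simp [w, hmp, hmq]
  have hwp : w p = Ψ q 0 := by
    simp [w, hpq]
  -- an `a₀` with non-zero coordinates orthogonal to `c`: correct a vector `u` along `e_q`
  have key : ∀ u : Fin 4 → K, (∀ k, k ≠ q → u k ≠ 0) → c ⬝ᵥ u ≠ Ψ q 0 * u q →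
      ∃ a₀ : Fin 4 → K, (∀ k, a₀ k ≠ 0) ∧ c ⬝ᵥ a₀ = 0 := by
    intro u hu hne
    refine ⟨u - ((c ⬝ᵥ u) / Ψ q 0) • Pi.single q 1, ?_, ?_⟩
    · intro k
      by_cases hkq : k = q
      · rw [hkq]
        have e : (u - ((c ⬝ᵥ u) / Ψ q 0) • (Pi.single q 1 : Fin 4 → K)) q =
            (Ψ q 0 * u q - c ⬝ᵥ u) / Ψ q 0 := by
          simp only [Pi.sub_apply, Pi.smul_apply, Pi.single_eq_same, smul_eq_mul, mul_one]
          field_simp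
        rw [e]
        exact div_ne_zero (sub_ne_zero.mpr (Ne.symm hne)) hq
      · have e : (u - ((c ⬝ᵥ u) / Ψ q 0) • (Pi.single q 1 : Fin 4 → K)) k = u k := by
          simp [hkq]
        rw [e]
        exact hu k hkq
    · have hcq : c q = Ψ q 0 := rfl
      simp only [dotProduct_sub, dotProduct_smul, dotProduct_single, mul_one, smul_eq_mul, hcq]
      field_simp
      ring
  obtain ⟨a₀, ha, hca₀⟩ : ∃ a₀ : Fin 4 → K, (∀ k, a₀ k ≠ 0) ∧ c ⬝ᵥ a₀ = 0 := by
    by_cases hS : c ⬝ᵥ (fun _ => (1 : K)) = Ψ q 0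
    · -- `u = 𝟙 + e_p`
      refine key ((fun _ => (1 : K)) + Pi.single p 1) ?_ ?_
      · intro k _
        by_cases hkp : k = p
        · rw [hkp]; simp
        · simp [hkp]
      · have hcp : c p = Ψ p 0 := rfl
        have huq : ((fun _ : Fin 4 => (1 : K)) + (Pi.single p 1 : Fin 4 → K)) q = 1 := by
          rw [Pi.add_apply, Pi.single_eq_of_ne (Ne.symm hpq), add_zero]
        rw [dotProduct_add, dotProduct_single, hS, huq, hcp, mul_one, mul_one]
        intro e
        exact hp (by linear_combination e)
    · -- `u = 𝟙`
      exact key (fun _ => (1 : K)) (fun k _ => one_ne_zero) (by rwa [mul_one])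
  -- `a₁ = a₀ + w`
  have hind : ∀ μ : K, a₀ + w ≠ μ • a₀ := by
    intro μ e
    have em := congr_fun e m
    have ep := congr_fun e p
    simp only [Pi.add_apply, Pi.smul_apply, smul_eq_mul, hwm, add_zero] at em
    have hμ : μ = 1 := by
      have := mul_right_cancel₀ (ha m) (show (1 : K) * a₀ m = μ * a₀ m by rw [one_mul]; exact em)
      exact this.symm
    rw [hμ, Pi.add_apply, Pi.smul_apply, one_smul, hwp] at ep
    exact hq (by linear_combination ep)
  have hca₁ : c ⬝ᵥ (a₀ + w) = 0 := by rw [dotProduct_add, hca₀, hcw, add_zero]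
  have hz₀ : (![5, -1, -1, 0] : Fin 4 → K) 3 = 0 := by simp
  have hz₁ : (![3, 0, -1, 0] : Fin 4 → K) 3 = 0 := by simp
  exact frames_of_e3_of_indep Ψ a₀ (a₀ + w) ha hind
    (hred a₀ _ a₀ hz₀ hca₀) (hred a₀ _ a₀ hz₁ hca₀) (hred _ _ a₀ hz₀ hca₁) (hred _ _ a₀ hz₁ hca₁)

end Summit.ValiantsHypothesis.ValiantsHypothesis.Theorems.SymPencilPerFourPeeledTwoPencilColumnKill

end
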